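import Literature.AnabelianGeometry.AbsoluteAnabelian.FreeProSigmaCompletionBridge
import Literature.AnabelianGeometry.SemiGraphs.ProSigmaPuncturedSurfaceElastic
import Literature.AnabelianGeometry.SemiGraphs.ProSigmaSurfaceFreeProlRank
import HarnessLib

/-!
# Free pro-`Σ` groups of finite rank (`IsFreeProOn`): the rank `δ¹_ℓ = n`, open subgroups are free pro-`Σ`
# of rank `(n − 1)[G : U] + 1` (Schreier), elasticity ([AbsTopI] Lem 4.5 (i), Prop 2.3 (i), Thm 2.6)

S. Mochizuki, *Topics in Absolute Anabelian Geometry I: Generalities* (2012) [AbsTopI] (lit key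
`paper:url-11ac98ba15fc`): Lemma 4.5 (i) p. 54 ("`X` is non-proper if and only if every torsion-free
pro-`Σ` open subgroup of `Δ` is free pro-`Σ`"), Prop 2.3 (i) p. 19 ("`Δ` is slim and elastic"), and the
invariant `δ¹_ℓ` of Thm 2.6 p. 21.  Classical inputs: Ribes–Zalesskii, *Profinite Groups*, Thm 3.6.2
(open subgroups of free pro-`𝒞` groups are free pro-`𝒞`, with Schreier's index formula) and §3.3.

PROOF-ONLY continuation of `FreeProSigmaCompletionBridge.lean` (abc-iut-L4-t15: `IsFreeProOn G S gens ↔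
IsProSigmaCompletion S (FreeGroup.lift gens)` on profinite `G`).  Through the bridge, the model theorems
of the L3/L5/w5 files for pro-`Σ` completions of free groups (abc-iut-w5-d206's
`ProSigmaPuncturedSurfaceElastic.lean`: `freeProlRank_eq_card_of_isProSigmaCompletion_freeGroup`,
`freeProlRank_eq_of_isOpen_of_isProSigmaCompletion_freeGroup`, `isElastic_of_isProSigmaCompletion_freeGroup`;
abc-iut-L4-d1's `IsProSigmaCompletion.index_comap_of_isOpen`; abc-iut-L5-t9's `restrict`,
`of_comp_mulEquiv`; Mathlib's Nielsen–Schreier and the tree's `FreeGroup.card_generators_add_index`)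
become statements about the L4 predicate `IsFreeProOn` of [AbsTopI] Lem 4.5 (i):

* `IsFreeProOn.freeProlRank_eq` — `δ¹_ℓ(G) = n` for `ℓ ∈ Σ` prime; hence `IsFreeProOn.rank_unique` — the
  rank of a free pro-`Σ` group is well defined as soon as `Σ` contains a prime;
* `IsFreeProOn.freeProlRank_eq_of_isOpen` — `δ¹_ℓ(U) = (n − 1)·[G : U] + 1` for `U` open (`n ≥ 1`);
* `IsFreeProOn.exists_isFreeProOn_of_isOpen` — **an open subgroup `U` of a free pro-`Σ` group of rank
  `n ≥ 1` is free pro-`Σ` of rank `(n − 1)·[G : U] + 1`** (the `IsFreeProOn` form of Ribes–Zalesskii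
  3.6.2; at the affine model this is the input of the "if" direction of [AbsTopI] Lem 4.5 (i)), and
  `IsFreeProOn.isFreePro_of_isOpen` (the rank-free `IsFreePro U S`);
* `IsFreeProOn.isElastic` (`n ≥ 2`, `Σ ∋` a prime) and `IsFreeProOn.slim_and_elastic` — [AbsTopI] Prop 2.3
  (i) for free pro-`Σ` `Δ`, via abc-iut-w5-d206's elasticity of pro-`Σ` completions of free groups
  (rank route over `isElastic_of_affine_rankFormula`) and the bridge file's `IsFreeProOn.isSlimGroup`.

HONEST FRAMING: classical profinite group theory; refereed, undisputed; nothing here bears on [IUTchIII]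
Cor. 3.12; typed ≠ proved elsewhere.
-/

noncomputable section

open Topology

universe u

namespace Literature.AnabelianGeometry.AbsoluteAnabelian

open Literature.AnabelianGeometry.SemiGraphs.SemiGraphOfAnabelioids
open Literature.AnabelianGeometry.SemiGraphs.SemiGraphOfAnabelioids.IsProSigmaCompletion
open Literature.AlgebraicGeometry.Frobenioids (IsSlimGroup)
open Literature.GroupTheory.CombinatorialGroupTheory

variable {G : Type u} [Group G] [TopologicalSpace G] [IsTopologicalGroup G] [CompactSpace G]
  [T2Space G] [TotallyDisconnectedSpace G]
variable {S : Set ℕ} {n : ℕ} {gens : Fin n → G}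

/-! ### The rank `δ¹_ℓ` of a free pro-`Σ` group and of its open subgroups -/

/-- **`δ¹_ℓ(G) = n`** for a free pro-`Σ` group `G` of rank `n` (`IsFreeProOn G S gens`, `gens : Fin n → G`)
and a prime `ℓ ∈ Σ`: the free pro-`ℓ` rank of [AbsTopI] Thm 2.6 equals the number of free generators.
[cite: MochizukiAbsTopI2012, Thm 2.6 p.21] -/
theorem IsFreeProOn.freeProlRank_eq (h : IsFreeProOn G S gens) {ℓ : ℕ} [Fact ℓ.Prime] (hℓ : ℓ ∈ S) :
    freeProlRank G ℓ = (n : ℕ∞) := by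
  have h1 := freeProlRank_eq_card_of_isProSigmaCompletion_freeGroup h.isProSigmaCompletion_lift hℓ
  rwa [Fintype.card_fin] at h1

/-- **The rank of a free pro-`Σ` group is well defined** (when `Σ` contains a prime): if the profinite
group `G` is free pro-`Σ` on `gens : Fin n → G` and on `gens' : Fin n' → G`, then `n = n'` (both equal
`δ¹_ℓ(G)`). [cite: MochizukiAbsTopI2012, Thm 2.6 p.21] -/
theorem IsFreeProOn.rank_unique {n' : ℕ} {gens' : Fin n' → G} (h : IsFreeProOn G S gens)
    (h' : IsFreeProOn G S gens') (hS : ∃ ℓ ∈ S, ℓ.Prime) : n = n' := by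
  obtain ⟨ℓ, hℓS, hℓ⟩ := hS
  haveI : Fact ℓ.Prime := ⟨hℓ⟩
  have h1 := (h.freeProlRank_eq hℓS).symm.trans (h'.freeProlRank_eq hℓS)
  exact_mod_cast h1

/-- **`δ¹_ℓ(U) = (n − 1)·[G : U] + 1`** for an open subgroup `U` of a free pro-`Σ` group of rank `n ≥ 1`
and a prime `ℓ ∈ Σ` (Schreier's index formula, through the completion picture).
[cite: MochizukiAbsTopI2012, Thm 2.6 p.21] -/
theorem IsFreeProOn.freeProlRank_eq_of_isOpen (h : IsFreeProOn G S gens) (hn : 1 ≤ n) {ℓ : ℕ}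
    [Fact ℓ.Prime] (hℓ : ℓ ∈ S) (U : Subgroup G) (hU : IsOpen (U : Set G)) :
    freeProlRank U ℓ = (((n - 1) * U.index + 1 : ℕ) : ℕ∞) := by
  have h1 := freeProlRank_eq_of_isOpen_of_isProSigmaCompletion_freeGroup h.isProSigmaCompletion_lift hℓ
    (by rwa [Fintype.card_fin]) U hU
  rwa [Fintype.card_fin] at h1

/-! ### Open subgroups of free pro-`Σ` groups are free pro-`Σ` (Schreier) -/

omit [TopologicalSpace G] [IsTopologicalGroup G] [CompactSpace G] [T2Space G]
  [TotallyDisconnectedSpace G] [Group G] in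
/-- Schreier's count rearranged: `m + d = d·n + 1`, `n ≥ 1` ⇒ `m = (n − 1)·d + 1`. [folklore] -/
private theorem schreier_rank_arith {m d n : ℕ} (hn : 1 ≤ n) (h : m + d = d * n + 1) :
    m = (n - 1) * d + 1 := by
  obtain ⟨k, rfl⟩ : ∃ k, n = k + 1 := ⟨n - 1, by omega⟩
  have h2 : d * (k + 1) = d * k + d := Nat.mul_succ d k
  have h3 : (k + 1 - 1) * d = d * k := by rw [Nat.add_sub_cancel, Nat.mul_comm]
  omega


/-- **Open subgroups of a free pro-`Σ` group are free pro-`Σ`, with Schreier's rank formula**: if the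
profinite group `G` is free pro-`Σ` of rank `n ≥ 1` (`IsFreeProOn G S gens`) and `U ⊆ G` is open, then `U`
is free pro-`Σ` on some family of `(n − 1)·[G : U] + 1` elements.  (`G` is the pro-`Σ` completion of
`F_n` along `FreeGroup.lift gens`; `U` is the pro-`Σ` completion of the finite-index subgroup
`(lift gens)⁻¹ U ⊆ F_n` — free by Nielsen–Schreier, of rank `(n − 1)[F_n : (lift gens)⁻¹U] + 1` by
Schreier, and `[F_n : (lift gens)⁻¹ U] = [G : U]` — whence `U` is free pro-`Σ` by the converse bridge.)
This is the input of the "if" direction of [AbsTopI] Lem 4.5 (i) at the affine model.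
[cite: MochizukiAbsTopI2012, Lemma 4.5 (i) p.54] -/
theorem IsFreeProOn.exists_isFreeProOn_of_isOpen (h : IsFreeProOn G S gens) (hn : 1 ≤ n)
    (U : Subgroup G) (hU : IsOpen (U : Set G)) :
    ∃ (m : ℕ) (gens' : Fin m → U), IsFreeProOn U S gens' ∧ m = (n - 1) * U.index + 1 := by
  classical
  have hι := h.isProSigmaCompletion_lift
  -- `Γ' := (lift gens)⁻¹ U`: finite index `[G : U]`, free (Nielsen–Schreier), Schreier's count
  set Γ' : Subgroup (FreeGroup (Fin n)) := U.comap (FreeGroup.lift gens) with hΓ'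
  haveI : Γ'.FiniteIndex := hι.finiteIndex_comap U hU
  have hSch := (FreeGroup.card_generators_add_index (α := Fin n) Γ').1
  rw [Nat.card_eq_fintype_card (α := Fin n), Fintype.card_fin] at hSch
  have hidx : Γ'.index = U.index := hι.index_comap_of_isOpen U hU
  set m : ℕ := Nat.card (IsFreeGroup.Generators Γ') with hm
  have h2 : m + U.index = U.index * n + 1 := by rw [← hidx]; exact hSch
  have hmeq : m = (n - 1) * U.index + 1 := schreier_rank_arith hn h2
  have hne : m ≠ 0 := by omega
  haveI : Finite (IsFreeGroup.Generators Γ') := Nat.finite_of_card_ne_zero hne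
  letI : Fintype (IsFreeGroup.Generators Γ') := Fintype.ofFinite _
  have hcard : Fintype.card (IsFreeGroup.Generators Γ') = m := by
    rw [hm, Nat.card_eq_fintype_card]
  -- `U` (profinite) is the pro-`Σ` completion of `Γ' ≅ F(Generators Γ') ≅ F_m`
  haveI : CompactSpace U := isCompact_iff_compactSpace.mp (U.isClosed_of_isOpen hU).isCompact
  have hres : IsProSigmaCompletion S ((FreeGroup.lift gens).subgroupComap U) := hι.restrict U hU
  let e₁ : FreeGroup (IsFreeGroup.Generators Γ') ≃* Γ' := (IsFreeGroup.toFreeGroup Γ').symm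
  let eα : Fin m ≃ IsFreeGroup.Generators Γ' := (Fintype.equivFinOfCardEq hcard).symm
  let e : FreeGroup (Fin m) ≃* Γ' := (FreeGroup.freeGroupCongr eα).trans e₁
  let κ : FreeGroup (Fin m) →* U := ((FreeGroup.lift gens).subgroupComap U).comp e.toMonoidHom
  have hκ : IsProSigmaCompletion S κ := hres.of_comp_mulEquiv e fun _ => rfl
  have hlift : FreeGroup.lift (fun i => κ (FreeGroup.of i)) = κ :=
    FreeGroup.ext_hom _ _ fun i => FreeGroup.lift_apply_of
  have hκ' : IsProSigmaCompletion S (FreeGroup.lift fun i => κ (FreeGroup.of i)) := by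
    rw [hlift]; exact hκ
  exact ⟨m, fun i => κ (FreeGroup.of i), isFreeProOn_of_isProSigmaCompletion_lift hκ', hmeq⟩

/-- **Open subgroups of a free pro-`Σ` group of finite rank `≥ 1` are free pro-`Σ` of finite rank**
(the rank-free `IsFreePro` form of [AbsTopI] Lem 4.5 (i)'s vocabulary).
[cite: MochizukiAbsTopI2012, Lemma 4.5 (i) p.54] -/
theorem IsFreeProOn.isFreePro_of_isOpen (h : IsFreeProOn G S gens) (hn : 1 ≤ n) (U : Subgroup G)
    (hU : IsOpen (U : Set G)) : IsFreePro U S := by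
  obtain ⟨m, gens', hfree, -⟩ := h.exists_isFreeProOn_of_isOpen hn U hU
  exact ⟨m, gens', hfree⟩

/-! ### Elasticity ([AbsTopI] Prop 2.3 (i) for free pro-`Σ` `Δ`) -/

/-- **A free pro-`Σ` group of rank `n ≥ 2` is ELASTIC** when `Σ` contains a prime ([AbsTopI] Def 1.1
(ii); Prop 2.3 (i) for `Δ` free pro-`Σ`, [MT] Thm 1.5): through the bridge, abc-iut-w5-d206's
`isElastic_of_isProSigmaCompletion_freeGroup` (rank route: `δ¹_ℓ(U) = (n−1)[G:U] + 1` and abc-iut-L4-t15's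
`isElastic_of_affine_rankFormula`). [cite: MochizukiAbsTopI2012, Prop 2.3 (i) p.19] -/
theorem IsFreeProOn.isElastic (h : IsFreeProOn G S gens) (hn : 2 ≤ n) (hS : ∃ ℓ ∈ S, ℓ.Prime) :
    IsElastic G :=
  isElastic_of_isProSigmaCompletion_freeGroup (α := Fin n) (by rwa [Fintype.card_fin])
    h.isProSigmaCompletion_lift hS

/-- **[AbsTopI] Prop 2.3 (i) for a free pro-`Σ` group of rank `n ≥ 2`** (`Σ` containing a prime): "`Δ` is
slim and elastic" — slim by `IsFreeProOn.isSlimGroup` (bridge file), elastic by `IsFreeProOn.isElastic`.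
[cite: MochizukiAbsTopI2012, Prop 2.3 (i) p.19] -/
theorem IsFreeProOn.slim_and_elastic (h : IsFreeProOn G S gens) (hn : 2 ≤ n)
    (hS : ∃ ℓ ∈ S, ℓ.Prime) : IsSlimGroup G ∧ IsElastic G :=
  ⟨h.isSlimGroup hn, h.isElastic hn hS⟩

/-- **Open subgroups of a free pro-`Σ` group of rank `n ≥ 2` are again slim and elastic free pro-`Σ`
groups of rank `≥ 2`** (`(n−1)[G:U] + 1 ≥ n ≥ 2`): the hereditary form used when `Δ` is replaced by an
open subgroup ([AbsTopI] §1–2 pass to open subgroups freely). [cite: MochizukiAbsTopI2012, Prop 2.3 (i) p.19] -/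
theorem IsFreeProOn.slim_and_elastic_of_isOpen (h : IsFreeProOn G S gens) (hn : 2 ≤ n)
    (hS : ∃ ℓ ∈ S, ℓ.Prime) (U : Subgroup G) (hU : IsOpen (U : Set G)) :
    IsSlimGroup U ∧ IsElastic U := by
  obtain ⟨m, gens', hfree, hm⟩ := h.exists_isFreeProOn_of_isOpen (by omega) U hU
  haveI : Finite (G ⧸ U) := Subgroup.quotient_finite_of_isOpen U hU
  haveI : U.FiniteIndex := Subgroup.finiteIndex_of_finite_quotient
  have hidx : 1 ≤ U.index := Nat.pos_of_ne_zero Subgroup.FiniteIndex.index_ne_zero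
  have hm2 : 2 ≤ m := by
    rw [hm]
    have : 1 * 1 ≤ (n - 1) * U.index := Nat.mul_le_mul (by omega) hidx
    omega
  haveI : CompactSpace U := isCompact_iff_compactSpace.mp (U.isClosed_of_isOpen hU).isCompact
  exact hfree.slim_and_elastic hm2 hS

end Literature.AnabelianGeometry.AbsoluteAnabelian

end
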